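import Literature.MathematicalPhysics.QuantumFieldTheory.Balaban1983to89.MatrixNorms
import Mathlib.Analysis.Calculus.Deriv.Comp
import Mathlib.Analysis.Calculus.Deriv.Add
import Mathlib.Analysis.Calculus.Deriv.Mul

/-!
# `Balaban1983to89.B7Eq138FunctionalDerivative` — T. Bałaban, *Averaging operations for lattice gauge theories*, Commun. Math.
Phys. **98** (1985) 17–51 [Balaban1985Averaging], Sect. E p. 39 [PDF 23]: **the functional derivative `δF(A)/δA_b` of (137)–(138)
AS AN OBJECT on matrix-valued bond fields, with (138) and the sentence "the functional derivative coincides with partial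
derivatives (gradient) of F(A) multiplied by η^{−d}" as kernel theorems**

statement-level skeleton of published theorems with citation tags; proofs where landed; nothing here is a claim about the Yang–Mills mass gap

PDF held: `paper:balaban1985-cmp98-averaging` (journal page = PDF page + 16); render
`pub-balaban/b2b-balaban-ref1/pages/1985-cmp98-averaging/1985-cmp98-averaging-p023-x2.png` (p. 39) read as an image by the typing
seat (unit `lit-balaban-r04`, gen 52), p. 20–21 renders for (17)–(18).

CITATION HEADER / PRINT, verbatim (p. 39): "This information is connected with a notion of the functional derivative. Let us
recall this notion. If `F(A)` is a differentiable function defined at field configurations `A` on `Ω`, then the differential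
`dF(A, δA) = (d/dt) F(A + tδA)|_{t=0}` (137)
is a linear functional of the variable `δA` and can be represented as a scalar product of `δA` and some Lie algebra valued
function. This function is called the functional derivative and is denoted by `(δ/δA)F(A)`, thus we have
`(d/dt) F(A + tδA)|_{t=0} = Σ_{b⊂Ω} η^d tr (δF(A)/δA_b) δA_b = ⟨δF(A)/δA, δA⟩.` (138)
From this definition it follows easily that the functional derivative coincides with partial derivatives (gradient) of `F(A)`
multiplied by `η^{−d}`."  (17) p. 20: "`⟨X, Y⟩ = tr X*Y`, `tr X = (1/N) Σ_j X_jj`"; (18) p. 21: "a scalar product in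
spaces of matrix valued functions defined on subsets `Ω ⊂ ηZ^d`, `⟨A, B⟩ = Σ_{x∈Ω} η^d ⟨A(x), B(x)⟩`, (18) similarly for functions
defined at bonds or plaquettes of `Ω`.".

CARRIER.  Print's `A`, `δA` are `𝔤`-valued (`𝔤 ⊂` hermitian `N × N` matrices) and, from Sect. A on, complexified
(`𝔤ᶜ ⊂ M_N(ℂ)`; "the complexification of the algebra of hermitian matrices is the algebra of all complex `N × N` matrices",
p. 20); the functions print differentiates ((134)–(136), Prop. 5) are analytic in `A ∈ (𝔤ᶜ)^Ω`.  This file types (137)–(138)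
for `G = U(N)`, i.e. on bond fields `A : S → M_N(ℂ)` over an arbitrary finite bond set `S` (print: the bonds of `Ω`), for
`ℂ`-differentiable `F : (S → M_N(ℂ)) → ℂ`, with the COMPLEX-BILINEAR pairing `Σ_b η^d tr(G_b δA_b)` of (138) (normalized
trace `MatrixNorms.ntr`; on hermitian values it is the scalar product (18), `fpair_eq_sum_nhsInner`).  The lattice weight
`η^d > 0` is the parameter `w`.  The B7 concrete lineage (`B7Prop1Explicit` …) works in a general Banach algebra `𝔸`, which
has no trace: there (137) is the directional derivative `B7Ineq148.dPair` ∕ `B7Prop5Flat.dC` and the single-bond direction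
of (138) is `B7Prop5Flat` §3; the OBJECT `δF/δA_b` needs the matrix carrier and is supplied here.
-- TODO(general form): for a proper subgroup `G ⊊ U(N)` print's `δF/δA_b ∈ 𝔤ᶜ ⊊ M_N(ℂ)` is the component of `funcDeriv`
-- along `𝔤ᶜ` for the (nondegenerate) restricted trace form; only the full matrix algebra is typed.

WHAT THIS FILE PROVES (kernel, 0 sorry, standard axioms; two plumbing definitions with bodies, no `def … : Prop`).
* `fpair w G δA := Σ_b w·tr(G_b δA_b)` — the pairing of (138); `dF F A δA := (d/dt) F(A + tδA)|_{t=0}` — (137).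
* **`funcDeriv w F A b`** — the functional derivative, GIVEN BY print's closing sentence: its `(i, j)` entry is `(N/w)` times the
  partial derivative of `F` at `A` in the direction of the matrix unit `E_{ji}` on the bond `b` (`N` from the normalized trace).
* **`hasDerivAt_eq138`** ∕ **`dF_eq_fpair_funcDeriv`** — (138): `(d/dt) F(A + tδA)|_{t=0} = Σ_b w·tr((δF/δA_b) δA_b)` for every
  `δA`, for `F` differentiable at `A` (`w ≠ 0`, `N ≥ 1`).
* **`funcDeriv_unique`** — "can be represented as a scalar product of `δA` and SOME … function": the representing function is
  unique (the pairing is nondegenerate, `fpair_left_injective`).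
* **`hasDerivAt_partial`** — "coincides with partial derivatives … multiplied by `η^{−d}`": the partial derivative of `F` along
  `E_{ji}·δ_b` is `(w/N)·(δF/δA_b)_{ij}`.
Owner audit context: ROWS-B7 row `B7.Eq137` ((137)–(141)); this member supplies the object of display (138).  Unit
`lit-balaban-r04` gen 52, 2026-08-23.
-/

open scoped BigOperators Matrix ComplexConjugate Matrix.Norms.L2Operator

namespace Literature.MathematicalPhysics.QuantumFieldTheory.Balaban1983to89

namespace B7Eq138FunctionalDerivative

open MatrixNorms

noncomputable section

variable {S : Type*} [Fintype S] [DecidableEq S]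
variable {n : Type*} [Fintype n] [DecidableEq n]

/-! ## §1 The pairing of (138) and the differential (137) -/

/-- The pairing of (138): `Σ_{b⊂Ω} η^d tr (G_b δA_b)` with the normalized trace `tr` of (17) (`MatrixNorms.ntr`) and the
lattice weight `w = η^d`; complex-bilinear (on hermitian values it is the scalar product (18), `fpair_eq_sum_nhsInner`).
[cite: Balaban1985Averaging, (138) p.39, (17)–(18) pp.20–21] -/
def fpair (w : ℝ) (G δA : S → Matrix n n ℂ) : ℂ := ∑ b, (w : ℂ) * ntr (G b * δA b)

/-- **(137)**: the differential `dF(A, δA) = (d/dt) F(A + tδA)|_{t=0}` (complex `t`; Mathlib's `deriv` at `0`).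
[cite: Balaban1985Averaging, (137) p.39] -/
def dF (F : (S → Matrix n n ℂ) → ℂ) (A δA : S → Matrix n n ℂ) : ℂ := deriv (fun t : ℂ => F (A + t • δA)) 0

omit [DecidableEq S] [DecidableEq n] in
/-- On hermitian-valued functions the pairing of (138) is the scalar product (18) built from (17) `⟨X, Y⟩ = tr X*Y`:
`Σ_b η^d tr(G_b δA_b) = Σ_b η^d ⟨G_b, δA_b⟩` when every `G_b` is hermitian. [cite: Balaban1985Averaging, (17)–(18) pp.20–21, (138) p.39] -/
theorem fpair_eq_sum_nhsInner (w : ℝ) {G : S → Matrix n n ℂ} (hG : ∀ b, (G b).IsHermitian) (δA : S → Matrix n n ℂ) :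
    fpair w G δA = ∑ b, (w : ℂ) * nhsInner (G b) (δA b) := by
  unfold fpair nhsInner
  refine Finset.sum_congr rfl fun b _ => ?_
  rw [(hG b).eq]

omit [DecidableEq S] in
/-- (137) along the line: `t ↦ F(A + tδA)` has derivative `dF(A)δA` (the Fréchet derivative applied to `δA`) at `t = 0`, for
`F` differentiable at `A` — "the differential … is a linear functional of the variable `δA`". [cite: Balaban1985Averaging, (137) p.39] -/
theorem hasDerivAt_line {F : (S → Matrix n n ℂ) → ℂ} {A : S → Matrix n n ℂ} (hF : DifferentiableAt ℂ F A)
    (δA : S → Matrix n n ℂ) :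
    HasDerivAt (fun t : ℂ => F (A + t • δA)) (fderiv ℂ F A δA) 0 := by
  have hℓ : HasDerivAt (fun t : ℂ => A + t • δA) δA 0 := by
    simpa using ((hasDerivAt_id (0 : ℂ)).smul_const δA).const_add A
  exact hF.hasFDerivAt.comp_hasDerivAt_of_eq 0 hℓ (by simp)

omit [DecidableEq S] in
/-- (137) = the Fréchet derivative applied to the direction: `dF(A, δA) = dF(A)δA`. [cite: Balaban1985Averaging, (137) p.39] -/
theorem dF_eq_fderiv {F : (S → Matrix n n ℂ) → ℂ} {A : S → Matrix n n ℂ} (hF : DifferentiableAt ℂ F A)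
    (δA : S → Matrix n n ℂ) : dF F A δA = fderiv ℂ F A δA :=
  (hasDerivAt_line hF δA).deriv

/-! ## §2 The functional derivative `δF/δA_b` and (138) -/

/-- A linear functional on `M_N(ℂ)` expanded along the matrix units: `ψ(M) = Σ_{ij} M_{ij} ψ(E_{ij})`. [folklore] -/
private theorem linear_apply_matrix_eq_sum (ψ : Matrix n n ℂ →ₗ[ℂ] ℂ) (M : Matrix n n ℂ) :
    ψ M = ∑ i, ∑ j, M i j * ψ (Matrix.single i j 1) := by
  conv_lhs => rw [Matrix.matrix_eq_sum_single M]
  simp only [map_sum]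
  refine Finset.sum_congr rfl fun i _ => Finset.sum_congr rfl fun j _ => ?_
  rw [show Matrix.single i j (M i j) = M i j • Matrix.single i j (1 : ℂ) by
    rw [Matrix.smul_single, smul_eq_mul, mul_one], map_smul, smul_eq_mul]

/-- "the differential … is a linear functional of the variable `δA`": a (continuous) linear functional on bond fields is
determined by its values on the single-bond matrix units, `φ(δA) = Σ_b Σ_{ij} (δA_b)_{ij} φ(E_{ij}·δ_b)`. [cite: Balaban1985Averaging, (137)–(138) p.39] -/
theorem clm_apply_eq_sum (φ : (S → Matrix n n ℂ) →L[ℂ] ℂ) (δA : S → Matrix n n ℂ) :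
    φ δA = ∑ b, ∑ i, ∑ j, δA b i j * φ (Pi.single b (Matrix.single i j 1)) := by
  conv_lhs => rw [← Finset.univ_sum_single δA]
  rw [map_sum]
  refine Finset.sum_congr rfl fun b _ => ?_
  have h := linear_apply_matrix_eq_sum
    (φ.toLinearMap ∘ₗ LinearMap.single ℂ (fun _ : S => Matrix n n ℂ) b) (δA b)
  simpa [LinearMap.comp_apply] using h

/-- **The functional derivative `δF(A)/δA_b ∈ M_N(ℂ)`** of (138), defined by print's closing sentence ("coincides with partial
derivatives (gradient) of `F(A)` multiplied by `η^{−d}`"): its `(i, j)` entry is `(N/η^d)·dF(A)(E_{ji}·δ_b)`, the partial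
derivative of `F` at `A` along the matrix unit `E_{ji}` placed on the bond `b` (the transposition and the factor `N` come from
`tr(G δA_b) = (1/N) Σ_{ij} G_{ij}(δA_b)_{ji}`). [cite: Balaban1985Averaging, (138) p.39] -/
def funcDeriv (w : ℝ) (F : (S → Matrix n n ℂ) → ℂ) (A : S → Matrix n n ℂ) (b : S) : Matrix n n ℂ :=
  Matrix.of fun i j => ((Fintype.card n : ℂ) / (w : ℂ)) * fderiv ℂ F A (Pi.single b (Matrix.single j i 1))

/-- The pairing of the functional derivative with `δA` IS the differential: `Σ_b η^d tr((δF/δA_b) δA_b) = dF(A)δA`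
(`η^d ≠ 0`, `N ≥ 1`). [cite: Balaban1985Averaging, (138) p.39] -/
theorem fpair_funcDeriv [Nonempty n] {w : ℝ} (hw : w ≠ 0) (F : (S → Matrix n n ℂ) → ℂ) (A δA : S → Matrix n n ℂ) :
    fpair w (funcDeriv w F A) δA = fderiv ℂ F A δA := by
  have hw' : (w : ℂ) ≠ 0 := by exact_mod_cast hw
  have hN : (Fintype.card n : ℂ) ≠ 0 := by exact_mod_cast Fintype.card_ne_zero
  rw [clm_apply_eq_sum, fpair]
  refine Finset.sum_congr rfl fun b _ => ?_
  simp only [ntr, Matrix.trace, Matrix.diag_apply, Matrix.mul_apply, funcDeriv, Matrix.of_apply]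
  rw [Finset.sum_comm, Finset.sum_div, Finset.mul_sum]
  refine Finset.sum_congr rfl fun i _ => ?_
  rw [Finset.sum_div, Finset.mul_sum]
  refine Finset.sum_congr rfl fun j _ => ?_
  field_simp

/-- **(138)**: "`(d/dt) F(A + tδA)|_{t=0} = Σ_{b⊂Ω} η^d tr (δF(A)/δA_b) δA_b = ⟨δF(A)/δA, δA⟩`" — for every `F` differentiable
at the bond field `A` (values in `M_N(ℂ)`, `N ≥ 1`), every direction `δA`, every lattice weight `η^d ≠ 0`.
[cite: Balaban1985Averaging, (138) p.39] -/
theorem hasDerivAt_eq138 [Nonempty n] {w : ℝ} (hw : w ≠ 0) {F : (S → Matrix n n ℂ) → ℂ} {A : S → Matrix n n ℂ}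
    (hF : DifferentiableAt ℂ F A) (δA : S → Matrix n n ℂ) :
    HasDerivAt (fun t : ℂ => F (A + t • δA)) (fpair w (funcDeriv w F A) δA) 0 := by
  rw [fpair_funcDeriv hw]
  exact hasDerivAt_line hF δA

/-- (138) with (137): `dF(A, δA) = ⟨δF(A)/δA, δA⟩`. [cite: Balaban1985Averaging, (137)–(138) p.39] -/
theorem dF_eq_fpair_funcDeriv [Nonempty n] {w : ℝ} (hw : w ≠ 0) {F : (S → Matrix n n ℂ) → ℂ} {A : S → Matrix n n ℂ}
    (hF : DifferentiableAt ℂ F A) (δA : S → Matrix n n ℂ) :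
    dF F A δA = fpair w (funcDeriv w F A) δA :=
  (hasDerivAt_eq138 hw hF δA).deriv

/-! ## §3 Uniqueness of the representing function, and the partial derivatives -/

/-- The trace of `G·E_{ji}` is the entry `G_{ij}`. [folklore] -/
private theorem trace_mul_single (G : Matrix n n ℂ) (i j : n) :
    (G * Matrix.single j i (1 : ℂ)).trace = G i j := by
  rw [Matrix.trace_mul_single, MulOpposite.op_one, one_smul]

/-- The pairing against the single-bond matrix unit `E_{ji}·δ_b` reads off `(w/N)·(G_b)_{ij}`. [cite: Balaban1985Averaging, (138) p.39] -/
theorem fpair_single (w : ℝ) (G : S → Matrix n n ℂ) (b : S) (i j : n) :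
    fpair w G (Pi.single b (Matrix.single j i 1)) = (w : ℂ) / Fintype.card n * G b i j := by
  unfold fpair
  rw [Finset.sum_eq_single b]
  · rw [Pi.single_eq_same, ntr, trace_mul_single]; ring
  · intro b' _ hb'
    rw [Pi.single_eq_of_ne hb', mul_zero, ntr, Matrix.trace_zero, zero_div, mul_zero]
  · intro h; exact absurd (Finset.mem_univ b) h

/-- The pairing of (138) is nondegenerate in its first argument (`η^d ≠ 0`, `N ≥ 1`): a bond field is determined by its
pairings with all `δA`. [cite: Balaban1985Averaging, (138) p.39] -/
theorem fpair_left_injective [Nonempty n] {w : ℝ} (hw : w ≠ 0) {G G' : S → Matrix n n ℂ}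
    (h : ∀ δA, fpair w G δA = fpair w G' δA) : G = G' := by
  have hw' : (w : ℂ) ≠ 0 := by exact_mod_cast hw
  have hN : (Fintype.card n : ℂ) ≠ 0 := by exact_mod_cast Fintype.card_ne_zero
  funext b
  ext i j
  have hb := h (Pi.single b (Matrix.single j i 1))
  rw [fpair_single, fpair_single] at hb
  exact mul_left_cancel₀ (div_ne_zero hw' hN) hb

/-- **"… can be represented as a scalar product of `δA` and some Lie algebra valued function. This function is called the
functional derivative"** — UNIQUENESS: any bond field `G` with `dF(A)δA = Σ_b η^d tr(G_b δA_b)` for all `δA` is `δF(A)/δA`.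
[cite: Balaban1985Averaging, (138) p.39] -/
theorem funcDeriv_unique [Nonempty n] {w : ℝ} (hw : w ≠ 0) {F : (S → Matrix n n ℂ) → ℂ} {A : S → Matrix n n ℂ}
    {G : S → Matrix n n ℂ} (hG : ∀ δA, fpair w G δA = fderiv ℂ F A δA) : G = funcDeriv w F A :=
  fpair_left_injective hw fun δA => by rw [hG, fpair_funcDeriv hw]

/-- **"From this definition it follows easily that the functional derivative coincides with partial derivatives (gradient) of
`F(A)` multiplied by `η^{−d}`"**: the partial derivative of `F` at `A` along the matrix unit `E_{ji}` on the bond `b` is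
`(η^d/N)·(δF(A)/δA_b)_{ij}` — i.e. `(δF/δA_b)_{ij} = η^{−d}·N·∂F/∂(A_b)_{ji}`, the gradient for the normalized trace form (17)
times `η^{−d}`. [cite: Balaban1985Averaging, (138) p.39, (17) p.20] -/
theorem hasDerivAt_partial [Nonempty n] {w : ℝ} (hw : w ≠ 0) {F : (S → Matrix n n ℂ) → ℂ} {A : S → Matrix n n ℂ}
    (hF : DifferentiableAt ℂ F A) (b : S) (i j : n) :
    HasDerivAt (fun t : ℂ => F (A + t • (Pi.single b (Matrix.single j i (1 : ℂ)) : S → Matrix n n ℂ)))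
      ((w : ℂ) / Fintype.card n * funcDeriv w F A b i j) 0 := by
  have h := hasDerivAt_eq138 hw hF (Pi.single b (Matrix.single j i (1 : ℂ)) : S → Matrix n n ℂ)
  rwa [fpair_single] at h

/-- The entry formula, solved: `(δF(A)/δA_b)_{ij} = (N/η^d)·(d/dt) F(A + tE_{ji}δ_b)|_{t=0}`. [cite: Balaban1985Averaging, (138) p.39] -/
theorem funcDeriv_apply_eq_dF {w : ℝ} {F : (S → Matrix n n ℂ) → ℂ} {A : S → Matrix n n ℂ}
    (hF : DifferentiableAt ℂ F A) (b : S) (i j : n) :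
    funcDeriv w F A b i j = (Fintype.card n : ℂ) / w * dF F A (Pi.single b (Matrix.single j i (1 : ℂ))) := by
  rw [dF_eq_fderiv hF, funcDeriv, Matrix.of_apply]

end

end B7Eq138FunctionalDerivative

end Literature.MathematicalPhysics.QuantumFieldTheory.Balaban1983to89
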